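import Mathlib
import Literature.Geometry.DiscreteGeometry.KissingPatterns
import Summits.AtomisticToContinuum.Crystallization.Theorems.DisclinationRationFiveFoldRationStubPoleLemmaAux

/-!
# Crux `DisclinationRation.FiveFoldRation` (stmt-AtomisticToContinuum-15799), line `Sketch` —
# helpers for stub `stub_dr5_shellMutual` (shell symmetry), part 1: covering properties

The three patterns of the alphabet — the cuboctahedron `fccKissingPattern`, the anticuboctahedron
`hcpKissingPattern` and the decahedral pattern `Deca = {±e₃} ∪ {(√3/2·cos(2πk/5), √3/2·sin(2πk/5),
±1/2)}` — are `1/2`-COVERING: every unit vector `v` has a pattern point `w` with `⟪v, w⟫ ≥ 1/2`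
(angular covering radius `≤ 60°`).  For the two scaled integer patterns this is a sign/permutation
case analysis reduced to linear arithmetic (`dr5sm_pick`); for `Deca` one takes a pole if
`|v₂| ≥ 1/2` and otherwise the ring point maximising the horizontal inner product, whose
maximality against its two ring-mates (rotation by `72°`) forces the angle to be `≤ 36°`
(`dr5sm_deca_alg`, angle-free).  Also: `Deca` consists of unit vectors and is `1`-separated
(using `cos(2πk/5) ≤ 1/3` for `k ≠ 0`).  Helper prefix `dr5sm_`; the decahedral trigonometry and
distances are those of `…StubPoleLemmaAux` (`dr5pl_`).  Terms are written out (no local notations).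
-/

noncomputable section

namespace Summit.AtomisticToContinuum.Crystallization.Theorems

open Literature.Geometry.DiscreteGeometry

/-! ### Covering property of the scaled integer patterns -/

/-- Coordinates of a unit vector of `ℝ³`. -/
theorem dr5sm_unit_coords (v : EuclideanSpace ℝ (Fin 3)) (hv : ‖v‖ = 1) :
    v 0 ^ 2 + v 1 ^ 2 + v 2 ^ 2 = 1 := by
  have h := EuclideanSpace.norm_sq_eq v
  rw [hv, one_pow, Fin.sum_univ_three] at h
  simp only [Real.norm_eq_abs, sq_abs] at h
  linarith

/-- A point of a scaled integer pattern in a given direction: if `(p, q, r) ∈ P` has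
`L := p v₀ + q v₁ + r v₂ ≥ 0` and `4 L² ≥ N`, then `⟪v, (p, q, r)/√N⟫ ≥ 1/2`. -/
theorem dr5sm_pick {P : Finset (Fin 3 → ℤ)} {N : ℕ} (hN : N ≠ 0) (v : EuclideanSpace ℝ (Fin 3))
    (p q r : ℤ)
    (hm : ![p, q, r] ∈ P) (h0 : 0 ≤ v 0 * p + v 1 * q + v 2 * r)
    (h1 : (N : ℝ) ≤ 4 * (v 0 * p + v 1 * q + v 2 * r) ^ 2) :
    ∃ w ∈ scaledPattern P N, (1 / 2 : ℝ) ≤ inner ℝ v w := by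
  refine ⟨(Real.sqrt N)⁻¹ • intVec ![p, q, r], Finset.mem_image_of_mem _ hm, ?_⟩
  have hL : inner ℝ v (intVec ![p, q, r]) = v 0 * p + v 1 * q + v 2 * r := by
    simp [PiLp.inner_apply, Fin.sum_univ_three, intVec_apply]; ring
  have hpos : (0 : ℝ) < Real.sqrt N := Real.sqrt_pos.2 (by exact_mod_cast Nat.pos_of_ne_zero hN)
  rw [inner_smul_right, hL, le_inv_mul_iff₀ hpos]
  have h2 : Real.sqrt N ≤ 2 * (v 0 * p + v 1 * q + v 2 * r) := by
    rw [Real.sqrt_le_iff]; constructor <;> linarith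
  linarith

/-- **Covering property of the fcc pattern**: every unit vector is within `60°` of a vertex of
the cuboctahedron. (Drop a coordinate of square `≤ 1/2` and match the signs of the other two.) -/
theorem dr5sm_fcc_cover (v : EuclideanSpace ℝ (Fin 3)) (hv : ‖v‖ = 1) :
    ∃ w ∈ fccKissingPattern, (1 / 2 : ℝ) ≤ inner ℝ v w := by
  have hn := dr5sm_unit_coords v hv
  unfold fccKissingPattern
  by_cases h2 : v 2 ^ 2 ≤ 1 / 2
  · rcases le_total 0 (v 0) with ha | ha <;> rcases le_total 0 (v 1) with hb | hb
    · exact dr5sm_pick two_ne_zero v 1 1 0 (by decide) (by norm_num; linarith)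
        (by norm_num; nlinarith)
    · exact dr5sm_pick two_ne_zero v 1 (-1) 0 (by decide) (by norm_num; linarith)
        (by norm_num; nlinarith)
    · exact dr5sm_pick two_ne_zero v (-1) 1 0 (by decide) (by norm_num; linarith)
        (by norm_num; nlinarith)
    · exact dr5sm_pick two_ne_zero v (-1) (-1) 0 (by decide) (by norm_num; linarith)
        (by norm_num; nlinarith)
  · rcases le_total 0 (v 1) with hb | hb <;> rcases le_total 0 (v 2) with hc | hc
    · exact dr5sm_pick two_ne_zero v 0 1 1 (by decide) (by norm_num; linarith)
        (by norm_num; nlinarith)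
    · exact dr5sm_pick two_ne_zero v 0 1 (-1) (by decide) (by norm_num; linarith)
        (by norm_num; nlinarith)
    · exact dr5sm_pick two_ne_zero v 0 (-1) 1 (by decide) (by norm_num; linarith)
        (by norm_num; nlinarith)
    · exact dr5sm_pick two_ne_zero v 0 (-1) (-1) (by decide) (by norm_num; linarith)
        (by norm_num; nlinarith)

/-- **Covering property of the hcp pattern** (anticuboctahedron). With `s := v₀ + v₁ + v₂`: for
`s ≥ 11/10` a vertex of the upper triangle, for `s ≤ -11/10` one of the lower triangle, and
otherwise one of the hexagon is within `60°` of `v`. -/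
theorem dr5sm_hcp_cover (v : EuclideanSpace ℝ (Fin 3)) (hv : ‖v‖ = 1) :
    ∃ w ∈ hcpKissingPattern, (1 / 2 : ℝ) ≤ inner ℝ v w := by
  have hn := dr5sm_unit_coords v hv
  unfold hcpKissingPattern
  have h18 : (18 : ℕ) ≠ 0 := by norm_num
  by_cases hs : 11 / 10 ≤ v 0 + v 1 + v 2
  · -- upper triangle `(3,3,0), (3,0,3), (0,3,3)`
    by_cases hab : 11 / 15 ≤ v 0 + v 1
    · exact dr5sm_pick h18 v 3 3 0 (by decide) (by norm_num; linarith) (by norm_num; nlinarith)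
    by_cases hac : 11 / 15 ≤ v 0 + v 2
    · exact dr5sm_pick h18 v 3 0 3 (by decide) (by norm_num; linarith) (by norm_num; nlinarith)
    have hbc : 11 / 15 ≤ v 1 + v 2 := by linarith
    exact dr5sm_pick h18 v 0 3 3 (by decide) (by norm_num; linarith) (by norm_num; nlinarith)
  by_cases hs' : v 0 + v 1 + v 2 ≤ -(11 / 10)
  · -- lower triangle `(-1,-1,-4), (-1,-4,-1), (-4,-1,-1)`: quadruple the smallest coordinate
    rcases le_total (v 2) (v 0) with h20 | h02 <;> rcases le_total (v 2) (v 1) with h21 | h12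
    · exact dr5sm_pick h18 v (-1) (-1) (-4) (by decide) (by norm_num; linarith)
        (by norm_num; nlinarith)
    · exact dr5sm_pick h18 v (-1) (-4) (-1) (by decide) (by norm_num; linarith)
        (by norm_num; nlinarith)
    · exact dr5sm_pick h18 v (-4) (-1) (-1) (by decide) (by norm_num; linarith)
        (by norm_num; nlinarith)
    · rcases le_total (v 0) (v 1) with h01 | h10
      · exact dr5sm_pick h18 v (-4) (-1) (-1) (by decide) (by norm_num; linarith)
          (by norm_num; nlinarith)
      · exact dr5sm_pick h18 v (-1) (-4) (-1) (by decide) (by norm_num; linarith)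
          (by norm_num; nlinarith)
  -- hexagon `±(3,-3,0), ±(3,0,-3), ±(0,3,-3)`: the largest coordinate difference
  push Not at hs hs'
  have hsum : 3 / 2 ≤ (v 0 - v 1) ^ 2 + (v 0 - v 2) ^ 2 + (v 1 - v 2) ^ 2 := by nlinarith
  by_cases h1 : 1 / 2 ≤ (v 0 - v 1) ^ 2
  · rcases le_total (v 1) (v 0) with h | h
    · exact dr5sm_pick h18 v 3 (-3) 0 (by decide) (by norm_num; linarith) (by norm_num; nlinarith)
    · exact dr5sm_pick h18 v (-3) 3 0 (by decide) (by norm_num; linarith) (by norm_num; nlinarith)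
  by_cases h2 : 1 / 2 ≤ (v 0 - v 2) ^ 2
  · rcases le_total (v 2) (v 0) with h | h
    · exact dr5sm_pick h18 v 3 0 (-3) (by decide) (by norm_num; linarith) (by norm_num; nlinarith)
    · exact dr5sm_pick h18 v (-3) 0 3 (by decide) (by norm_num; linarith) (by norm_num; nlinarith)
  have h3 : 1 / 2 ≤ (v 1 - v 2) ^ 2 := by linarith
  rcases le_total (v 2) (v 1) with h | h
  · exact dr5sm_pick h18 v 0 3 (-3) (by decide) (by norm_num; linarith) (by norm_num; nlinarith)
  · exact dr5sm_pick h18 v 0 (-3) 3 (by decide) (by norm_num; linarith) (by norm_num; nlinarith)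

/-! ### The decahedral pattern: unit vectors, `1`-separated, `1/2`-covering -/

/-- For `k : Fin 5`, `k ≠ 0`: `cos(2πk/5) ≤ 1/3` (sharpening `dr5pl_cos_le_of_ne_zero`; the true
values are `(√5-1)/4 ≈ 0.309` and `-(√5+1)/4`). -/
theorem dr5sm_cos_le_third (k : Fin 5) (hk : k ≠ 0) :
    Real.cos (2 * Real.pi * (k : ℝ) / 5) ≤ 1 / 3 := by
  have h9 := dr5pl_cos_le_of_ne_zero k hk
  rcases dr5pl_cos_root (k : ℕ) with h | h
  · rw [h] at h9; norm_num at h9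
  · nlinarith

/-- The decahedral pattern consists of unit vectors. -/
theorem dr5sm_deca_norm (x : EuclideanSpace ℝ (Fin 3))
    (hx : x ∈ {p : EuclideanSpace ℝ (Fin 3) | p = !₂[(0 : ℝ), 0, 1] ∨ p = !₂[(0 : ℝ), 0, -1] ∨
      ∃ k : Fin 5, ∃ σ : ℝ, (σ = 1 / 2 ∨ σ = -(1 / 2)) ∧
        p = !₂[Real.sqrt 3 / 2 * Real.cos (2 * Real.pi * (k : ℝ) / 5),
          Real.sqrt 3 / 2 * Real.sin (2 * Real.pi * (k : ℝ) / 5), σ]}) :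
    ‖x‖ = 1 := by
  rcases hx with rfl | rfl | ⟨k, σ, hσ, rfl⟩
  · rw [EuclideanSpace.norm_eq, Fin.sum_univ_three]; simp
  · rw [EuclideanSpace.norm_eq, Fin.sum_univ_three]; simp
  · rw [EuclideanSpace.norm_eq, Fin.sum_univ_three, Real.sqrt_eq_one]
    simp only [Matrix.cons_val_zero, Matrix.cons_val_one, Matrix.head_cons, Matrix.cons_val_two,
      Matrix.tail_cons, Real.norm_eq_abs, sq_abs]
    have h3 : Real.sqrt 3 ^ 2 = 3 := Real.sq_sqrt (by norm_num)
    have hσ2 : σ ^ 2 = 1 / 4 := by rcases hσ with rfl | rfl <;> norm_num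
    nlinarith [Real.sin_sq_add_cos_sq (2 * Real.pi * (k : ℝ) / 5)]

/-- Squared distance between the two poles. -/
theorem dr5sm_poles_dist_sq :
    dist (!₂[(0 : ℝ), 0, 1] : EuclideanSpace ℝ (Fin 3)) (!₂[(0 : ℝ), 0, -1]) ^ 2 = 4 := by
  rw [EuclideanSpace.dist_eq, Real.sq_sqrt (Finset.sum_nonneg fun i _ => sq_nonneg _),
    Fin.sum_univ_three]
  simp [Real.dist_eq]
  norm_num

/-- The decahedral pattern is `1`-separated (the shortest distances are `1`: pole to its ring,
ring point to its partner; ring-mates are at distance `√(3/2·(1 - cos 72°)) > 1`). -/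
theorem dr5sm_deca_sep (x x' : EuclideanSpace ℝ (Fin 3))
    (hx : x ∈ {p : EuclideanSpace ℝ (Fin 3) | p = !₂[(0 : ℝ), 0, 1] ∨ p = !₂[(0 : ℝ), 0, -1] ∨
      ∃ k : Fin 5, ∃ σ : ℝ, (σ = 1 / 2 ∨ σ = -(1 / 2)) ∧
        p = !₂[Real.sqrt 3 / 2 * Real.cos (2 * Real.pi * (k : ℝ) / 5),
          Real.sqrt 3 / 2 * Real.sin (2 * Real.pi * (k : ℝ) / 5), σ]})
    (hx' : x' ∈ {p : EuclideanSpace ℝ (Fin 3) | p = !₂[(0 : ℝ), 0, 1] ∨ p = !₂[(0 : ℝ), 0, -1] ∨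
      ∃ k : Fin 5, ∃ σ : ℝ, (σ = 1 / 2 ∨ σ = -(1 / 2)) ∧
        p = !₂[Real.sqrt 3 / 2 * Real.cos (2 * Real.pi * (k : ℝ) / 5),
          Real.sqrt 3 / 2 * Real.sin (2 * Real.pi * (k : ℝ) / 5), σ]})
    (hne : x ≠ x') : 1 ≤ dist x x' := by
  have key : 1 ≤ dist x x' ^ 2 := by
    rcases hx with rfl | rfl | ⟨k, σ, hσ, rfl⟩ <;> rcases hx' with rfl | rfl | ⟨k', σ', hσ', rfl⟩
    · exact absurd rfl hne
    · rw [dr5sm_poles_dist_sq]; norm_num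
    · rw [dist_comm, dr5pl_ring_axis_dist_sq]
      rcases hσ' with rfl | rfl <;> norm_num
    · rw [dist_comm, dr5sm_poles_dist_sq]; norm_num
    · exact absurd rfl hne
    · rw [dist_comm, dr5pl_ring_axis_dist_sq]
      rcases hσ' with rfl | rfl <;> norm_num
    · rw [dr5pl_ring_axis_dist_sq]
      rcases hσ with rfl | rfl <;> norm_num
    · rw [dr5pl_ring_axis_dist_sq]
      rcases hσ with rfl | rfl <;> norm_num
    · rw [dr5pl_ring_dist_sq]
      by_cases hkk : k = k'
      · subst hkk
        have hσσ : σ ≠ σ' := fun h => hne (by rw [h])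
        have h1 : (σ - σ') ^ 2 = 1 := by
          rcases hσ with rfl | rfl <;> rcases hσ' with rfl | rfl <;>
            first | exact absurd rfl hσσ | norm_num
        rw [sub_self, h1]
        simp
      · have hc := dr5sm_cos_le_third (k - k') (sub_ne_zero.2 hkk)
        nlinarith [sq_nonneg (σ - σ')]
  nlinarith [dist_nonneg (x := x) (y := x')]

/-- Algebraic core of the decahedral covering: if `X = x_k` is maximal among its neighbours
`x_{k±1} = C·X ± S·Y` (rotation by `72°`, `C = cos 72° ∈ [0,1)`, `S = sin 72° > 0`) and
`X² + Y² = a² + b² > 3/4`, then `√3/2·X + cσ ≥ 1/2` whenever `cσ ≥ 0`. -/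
theorem dr5sm_deca_alg {a b c σ C S X Y r : ℝ} (hCS : C ^ 2 + S ^ 2 = 1) (hC0 : 0 ≤ C)
    (hC1 : C < 1) (hS : 0 < S) (hXY : X ^ 2 + Y ^ 2 = a ^ 2 + b ^ 2)
    (habc : a ^ 2 + b ^ 2 + c ^ 2 = 1) (hc : c < 1 / 2) (hc' : -(1 / 2) < c) (hσ : 0 ≤ c * σ)
    (hpX : C * X + S * Y ≤ X) (hmX : C * X - S * Y ≤ X) (hr : r ^ 2 = 3) (hr0 : 0 ≤ r) :
    1 / 2 ≤ r / 2 * X + c * σ := by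
  have hX0 : 0 ≤ X := by nlinarith
  have h1C : 1 - C ≤ S := by
    have hSsq : (1 - C) ^ 2 ≤ S ^ 2 := by nlinarith [mul_nonneg hC0 (sub_nonneg.2 hC1.le)]
    nlinarith [add_pos hS (sub_pos.2 hC1)]
  have hY1 : S * Y ≤ S * X := by
    have : S * Y ≤ (1 - C) * X := by linarith
    exact this.trans (mul_le_mul_of_nonneg_right h1C hX0)
  have hY2 : S * (-Y) ≤ S * X := by
    have : S * (-Y) ≤ (1 - C) * X := by linarith
    exact this.trans (mul_le_mul_of_nonneg_right h1C hX0)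
  have hYX : Y ^ 2 ≤ X ^ 2 :=
    sq_le_sq' (by have := le_of_mul_le_mul_left hY2 hS; linarith) (le_of_mul_le_mul_left hY1 hS)
  have hX2 : 3 / 8 ≤ X ^ 2 := by
    nlinarith [mul_pos (sub_pos.2 hc) (by linarith : (0 : ℝ) < c + 1 / 2)]
  have hrX : 1 ≤ r * X := by nlinarith [mul_nonneg hr0 hX0]
  linarith

/-- **Covering property of the decahedral pattern**: every unit vector `v` is within `60°` of a
point of `Deca` — a pole if `|v₂| ≥ 1/2`, else the ring point on the side of `v₂` maximising
`v₀ cos θ_k + v₁ sin θ_k`. -/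
theorem dr5sm_deca_cover (v : EuclideanSpace ℝ (Fin 3)) (hv : ‖v‖ = 1) :
    ∃ w, w ∈ {p : EuclideanSpace ℝ (Fin 3) | p = !₂[(0 : ℝ), 0, 1] ∨ p = !₂[(0 : ℝ), 0, -1] ∨
      ∃ k : Fin 5, ∃ σ : ℝ, (σ = 1 / 2 ∨ σ = -(1 / 2)) ∧
        p = !₂[Real.sqrt 3 / 2 * Real.cos (2 * Real.pi * (k : ℝ) / 5),
          Real.sqrt 3 / 2 * Real.sin (2 * Real.pi * (k : ℝ) / 5), σ]} ∧
      (1 / 2 : ℝ) ≤ inner ℝ v w := by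
  have hn := dr5sm_unit_coords v hv
  have hin : ∀ w : EuclideanSpace ℝ (Fin 3), inner ℝ v w = v 0 * w 0 + v 1 * w 1 + v 2 * w 2 :=
      fun w => by
    simp only [PiLp.inner_apply, RCLike.inner_apply, conj_trivial, Fin.sum_univ_three]
    ring
  by_cases hc : 1 / 2 ≤ v 2
  · exact ⟨!₂[(0 : ℝ), 0, 1], Or.inl rfl, by rw [hin]; simp; linarith⟩
  by_cases hc' : v 2 ≤ -(1 / 2)
  · exact ⟨!₂[(0 : ℝ), 0, -1], Or.inr (Or.inl rfl), by rw [hin]; simp; linarith⟩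
  push Not at hc hc'
  obtain ⟨σ, hσ, hcσ⟩ : ∃ σ : ℝ, (σ = 1 / 2 ∨ σ = -(1 / 2)) ∧ 0 ≤ v 2 * σ := by
    rcases le_total 0 (v 2) with h | h
    · exact ⟨1 / 2, Or.inl rfl, by nlinarith⟩
    · exact ⟨-(1 / 2), Or.inr rfl, by nlinarith⟩
  obtain ⟨k, hk⟩ := Finite.exists_max fun j : Fin 5 =>
    v 0 * Real.cos (2 * Real.pi * (j : ℝ) / 5) + v 1 * Real.sin (2 * Real.pi * (j : ℝ) / 5)
  refine ⟨!₂[Real.sqrt 3 / 2 * Real.cos (2 * Real.pi * (k : ℝ) / 5),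
    Real.sqrt 3 / 2 * Real.sin (2 * Real.pi * (k : ℝ) / 5), σ], Or.inr (Or.inr ⟨k, σ, hσ, rfl⟩), ?_⟩
  have hk1 := hk (k + 1)
  have hk2 := hk (k - 1)
  simp only at hk1 hk2
  obtain ⟨hc1, hs1⟩ := dr5pl_cos_sin_sub (k + 1) k
  obtain ⟨hc2, hs2⟩ := dr5pl_cos_sin_sub k (k - 1)
  rw [add_sub_cancel_left] at hc1 hs1
  rw [sub_sub_cancel] at hc2 hs2
  rw [Real.cos_sub] at hc1 hc2
  rw [Real.sin_sub] at hs1 hs2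
  have h15 : 2 * Real.pi * ((1 : Fin 5) : ℝ) / 5 = 2 * Real.pi / 5 := by norm_num
  rw [h15] at hc1 hs1 hc2 hs2
  have hC0 : 0 ≤ Real.cos (2 * Real.pi / 5) :=
    Real.cos_nonneg_of_neg_pi_div_two_le_of_le (by linarith [Real.pi_pos])
      (by linarith [Real.pi_pos])
  have hC1 : Real.cos (2 * Real.pi / 5) < 1 := by
    have := dr5pl_cos_le_of_ne_zero 1 (by decide)
    rw [h15] at this
    linarith
  have hS : 0 < Real.sin (2 * Real.pi / 5) :=
    Real.sin_pos_of_pos_of_lt_pi (by positivity) (by linarith [Real.pi_pos])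
  have hCS := Real.cos_sq_add_sin_sq (2 * Real.pi / 5)
  have h3 : Real.sqrt 3 ^ 2 = 3 := Real.sq_sqrt (by norm_num)
  rw [hin]
  simp only [Matrix.cons_val_zero, Matrix.cons_val_one, Matrix.head_cons, Matrix.cons_val_two,
    Matrix.tail_cons]
  have key := dr5sm_deca_alg (σ := σ) (X := v 0 * Real.cos (2 * Real.pi * (k : ℝ) / 5) +
      v 1 * Real.sin (2 * Real.pi * (k : ℝ) / 5))
    (Y := v 1 * Real.cos (2 * Real.pi * (k : ℝ) / 5) - v 0 * Real.sin (2 * Real.pi * (k : ℝ) / 5))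
    hCS hC0 hC1 hS (by nlinarith [Real.sin_sq_add_cos_sq (2 * Real.pi * (k : ℝ) / 5)]) hn hc hc'
    hcσ ?_ ?_ h3 (Real.sqrt_nonneg 3)
  · linarith
  · have : Real.cos (2 * Real.pi / 5) * (v 0 * Real.cos (2 * Real.pi * (k : ℝ) / 5) +
        v 1 * Real.sin (2 * Real.pi * (k : ℝ) / 5)) + Real.sin (2 * Real.pi / 5) *
        (v 1 * Real.cos (2 * Real.pi * (k : ℝ) / 5) - v 0 * Real.sin (2 * Real.pi * (k : ℝ) / 5)) =
        v 0 * Real.cos (2 * Real.pi * ((k + 1 : Fin 5) : ℝ) / 5) +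
          v 1 * Real.sin (2 * Real.pi * ((k + 1 : Fin 5) : ℝ) / 5) := by
      rw [← hc1, ← hs1]
      linear_combination (v 0 * Real.cos (2 * Real.pi * ((k + 1 : Fin 5) : ℝ) / 5) +
        v 1 * Real.sin (2 * Real.pi * ((k + 1 : Fin 5) : ℝ) / 5)) *
        Real.sin_sq_add_cos_sq (2 * Real.pi * (k : ℝ) / 5)
    linarith
  · have : Real.cos (2 * Real.pi / 5) * (v 0 * Real.cos (2 * Real.pi * (k : ℝ) / 5) +
        v 1 * Real.sin (2 * Real.pi * (k : ℝ) / 5)) - Real.sin (2 * Real.pi / 5) *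
        (v 1 * Real.cos (2 * Real.pi * (k : ℝ) / 5) - v 0 * Real.sin (2 * Real.pi * (k : ℝ) / 5)) =
        v 0 * Real.cos (2 * Real.pi * ((k - 1 : Fin 5) : ℝ) / 5) +
          v 1 * Real.sin (2 * Real.pi * ((k - 1 : Fin 5) : ℝ) / 5) := by
      rw [← hc2, ← hs2]
      linear_combination (v 0 * Real.cos (2 * Real.pi * ((k - 1 : Fin 5) : ℝ) / 5) +
        v 1 * Real.sin (2 * Real.pi * ((k - 1 : Fin 5) : ℝ) / 5)) *
        Real.sin_sq_add_cos_sq (2 * Real.pi * (k : ℝ) / 5)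
    linarith

end Summit.AtomisticToContinuum.Crystallization.Theorems

end
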